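import Summits.CriticalPhenomena.PercolationContinuityZ3.Theorems.PercNearOneGluingNoHeavyQuantCompoundCut
import Summits.CriticalPhenomena.PercolationContinuityZ3.Theorems.PercNearOneGluingNoHeavyQuantLightIncrement
import HarnessLib

/-!
# QUANT lane R8, T-DEC: BUBBLE DATA — the data-determined gates, weights, floors and region of arm-1 g47's BUBBLE recursion (the closed-form,
# k-general solution of the conditioned-compound problem "PROBLEM(L_m, S′)"), its scalar identities, and the LEAF-ATOMIZATION data of the
# count-level upgrade ('identity I_k⁺': `gate ρ λ = Σ_m (ρ(m)·m/R)·gate δ_m (λR/m)`, the X-leaf as a finite family of versions)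

builds on p205010 (kernel theorem, internal audit signed; external expert review pending)

Support + definition file (`--supports stmt-CriticalPhenomena-4575`), QUANT lane seat prim-quant-arm-1 (gen 47, architect), rung R8 of
`run/shared/lean/prim/quant/LADDER.md`; memo `run/shared/lean/prim/quant/prim-quant-arm-1-g47/ARCH-G47.md` §2–§4, §8.  Definitions: the list functionals
`bT` (conditioned mean `fmean / fQ`), `bp` (the outer box's share), `bD` (step denominator), `blam`, `bkap` (the X- and Y-gates of one bubble step),
`bfl` (the bubble floor), `BubbleOK` (the region), `xfl` (floor term of an X-leaf: split or not), `bflS` (split-aware bubble floor); theorems with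
standard axioms, no sorries.  Continues `…QuantCompoundCut` (`fQ`, `fbeta`); imports census-2 g72's `…QuantLightIncrement` for the one-box atomic
re-gating identity `gate_eq_sum_regated_atoms` (found independently the same morning; its closure brings arm-1 g46's `gate_sum_affine` and typer g39's
`treeBuiltN_point`, both reused downstream).  The decomposition theorems and the k-general certificates are in `…QuantBubbleFamily` (identity I_k) and
`…QuantBubbleSplit` (identity I_k⁺).

ONE BUBBLE STEP (list `b :: L′`, outer box `b` revealed first, inner compound `L′ ≠ []` of conditioned mean `T = bT L′`, `R = mean ρ_b`,
`p = q_b / fQ (b :: L′)`, `Q′ = fQ L′`):  X-gate `λ = p(R − (1−Q′)T)/R` (box `b` hung under an inner hub), Y-gate `κ = ((1−p+pQ′)T − (1−p)R)/T`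
(the inner piece hung under the opened box `b`), weights `u = (1−p)R/D`, `v = p(1−Q′)T/D`, `D = (1−p)R + p(1−Q′)T`; identities `u + v = 1`,
`uλ + vκ = pQ′`, `u(1−λ) = 1−p`, `v(1−κ) = p(1−Q′)` (`bubble_scalars`); on the region `R > (1−Q′)T`, `(1−p+pQ′)T > (1−p)R` all of `p, λ, κ ∈ (0,1)`,
`D > 0`, and `bT (b :: L′) = pR + (1−p+pQ′)T` (`bubble_step_facts`).  LEAF ATOMIZATION (memo §8): an X-leaf `gate ρ_b λ` with `λ·R < r` (least charged
atom) equals `Σ_m (ρ_b(m)·m/R)·gate δ_m (λR/m)` — blobs of the SAME mean `λR` (census-2 g72's `gate_eq_sum_regated_atoms`; `leaf_versions`), so its floor requirement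
drops from `λ·x₁(b)` to `λ·R/M·y₀` (`xfl`, `bflS`); the carrier and every other box are untouched.

* `Sib.qmean_pos` (`0 < q·mean` for a tree-built composite sibling); `bT`, `bp`, `bD`, `blam`, `bkap`, `bfl`, `BubbleOK`; `bubble_scalars`,
  `bubble_step_facts`, `fmean_pos_of_treeOK`, `bT_pos`, `bfl_pos`;
* `xfl`, `bflS`; `leaf_versions` (blobs when `λR < r` — uncharged atoms below `r` represented by `δ_r` with weight 0 —,
  the box itself otherwise; common mean `λR`, floor `≥` the X-floor term); `bflS_pos`.

HONEST STATUS: bookkeeping for explicit sub-families; `SiblingStep`, `GateStepN`, `FarTreeRow` OPEN; RATE class log\* / honest sentence unchanged.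
[this work].  Nothing here is cited as a published result.  The gluing rows served [cite: KozmaNitzan2024, Conjecture 3 (p. 15)]; product measure
[cite: Grimmett1999, §1.3 p. 10].
-/

noncomputable section

open scoped BigOperators
open Classical

namespace Summit.CriticalPhenomena.PercolationContinuityZ3.Theorems
namespace Quant
namespace LawDec

open Finset

/-! ### A positivity tool -/

/-- **a tree-built COMPOSITE sibling contributes a positive gated mean**: `0 < q·mean ρ` (`M ≥ 1` since `ρ` is not a point mass; top-affordability).
[this work] -/
theorem Sib.qmean_pos {x : ℝ} (s : Sib) (h : s.TreeOK x) : 0 < s.q * s.mean := by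
  obtain ⟨hq0, _, _, hT, hnp⟩ := h
  obtain ⟨hx₁0, _, _, ρM, ρ1, ρta⟩ := hT.lawFacts
  have hM : 1 ≤ s.M := by
    by_contra hlt
    have hM0 : s.M = 0 := by omega
    refine hnp 0 (funext fun k => ?_)
    by_cases hk : k = 0
    · subst hk; rw [if_pos rfl]; have := ρ1; rw [hM0, Finset.sum_range_one] at this; exact this
    · rw [if_neg hk]; exact ρM k (by omega)
  have : 0 < s.x₁ * (s.M : ℝ) := mul_pos hx₁0 (by exact_mod_cast hM)
  exact mul_pos hq0 (lt_of_lt_of_le this ρta)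

/-! ### Bubble data -/

/-- conditioned mean of the compound: `fmean L / fQ L`. [this work] -/
def bT (L : List Sib) : ℝ := fmean L / fQ L

/-- the outer box's share of the conditioned compound: `p = q_b / fQ (b :: L′)`. [this work] -/
def bp (b : Sib) (L' : List Sib) : ℝ := b.q / fQ (b :: L')

/-- the step denominator `D = (1−p)·R + p(1−Q′)·T`. [this work] -/
def bD (b : Sib) (L' : List Sib) : ℝ := (1 - bp b L') * b.mean + bp b L' * (1 - fQ L') * bT L'

/-- the X-gate `λ = p(R − (1−Q′)T)/R` (outer box hung under an inner hub). [this work] -/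
def blam (b : Sib) (L' : List Sib) : ℝ := bp b L' * (b.mean - (1 - fQ L') * bT L') / b.mean

/-- the Y-gate `κ = ((1−p+pQ′)T − (1−p)R)/T` (inner piece hung under the opened outer box). [this work] -/
def bkap (b : Sib) (L' : List Sib) : ℝ := ((1 - bp b L' + bp b L' * fQ L') * bT L' - (1 - bp b L') * b.mean) / bT L'

/-- **the bubble floor**: the least (scaled) sub-forest floor over the final pieces. [this work] -/
def bfl : List Sib → ℝ
  | [] => 1
  | [s] => s.x₁
  | b :: s :: L => min (min (bfl (s :: L)) (blam b (s :: L) * b.x₁)) (min b.x₁ (bkap b (s :: L) * bfl (s :: L)))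

/-- **the bubble region**: at every step `λ > 0` (`R > (1−Q′)T`) and `κ > 0` (`(1−p+pQ′)T > (1−p)R`); false for the empty list. [this work] -/
def BubbleOK : List Sib → Prop
  | [] => False
  | [_] => True
  | b :: s :: L => BubbleOK (s :: L) ∧ (1 - fQ (s :: L)) * bT (s :: L) < b.mean ∧
      (1 - bp b (s :: L)) * b.mean < (1 - bp b (s :: L) + bp b (s :: L) * fQ (s :: L)) * bT (s :: L)

/-- **the four scalar identities of one bubble step** (pure algebra: `R, T ≠ 0`, `D = (1−p)R + p(1−Q)T ≠ 0`): with `u = (1−p)R/D`, `v = p(1−Q)T/D`,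
`λ = p(R − (1−Q)T)/R`, `κ = ((1−p+pQ)T − (1−p)R)/T`:  `u + v = 1`, `uλ + vκ = pQ`, `u(1−λ) = 1−p`, `v(1−κ) = p(1−Q)`. [this work] -/
theorem bubble_scalars (p Q R T : ℝ) (hR : R ≠ 0) (hT : T ≠ 0) (hD : (1 - p) * R + p * (1 - Q) * T ≠ 0) :
    (1 - p) * R / ((1 - p) * R + p * (1 - Q) * T) + p * (1 - Q) * T / ((1 - p) * R + p * (1 - Q) * T) = 1 ∧
    (1 - p) * R / ((1 - p) * R + p * (1 - Q) * T) * (p * (R - (1 - Q) * T) / R)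
      + p * (1 - Q) * T / ((1 - p) * R + p * (1 - Q) * T) * (((1 - p + p * Q) * T - (1 - p) * R) / T) = p * Q ∧
    (1 - p) * R / ((1 - p) * R + p * (1 - Q) * T) * (1 - p * (R - (1 - Q) * T) / R) = 1 - p ∧
    p * (1 - Q) * T / ((1 - p) * R + p * (1 - Q) * T) * (1 - ((1 - p + p * Q) * T - (1 - p) * R) / T) = p * (1 - Q) := by
  refine ⟨?_, ?_, ?_, ?_⟩
  · rw [← add_div, div_self hD]
  · field_simp
    ring
  · field_simp
    ring
  · field_simp
    ring

/-- **facts of one bubble step** (`b` law-valid with positive mean, `L′ ≠ []` law-valid, `0 < bT L′`, the two region inequalities): `0 < p < 1`,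
`0 < D`, `0 < λ < 1`, `0 < κ < 1`, and `bT (b :: L′) = p·R + (1−p+pQ′)·T`. [this work] -/
theorem bubble_step_facts (b : Sib) (L' : List Sib) (hb : b.LawOK) (hR : 0 < b.mean) (hL : ∀ s ∈ L', s.LawOK) (hne : L' ≠ [])
    (hT : 0 < bT L') (h1 : (1 - fQ L') * bT L' < b.mean) (h2 : (1 - bp b L') * b.mean < (1 - bp b L' + bp b L' * fQ L') * bT L') :
    0 < bp b L' ∧ bp b L' < 1 ∧ 0 < bD b L' ∧ 0 < blam b L' ∧ blam b L' < 1 ∧ 0 < bkap b L' ∧ bkap b L' < 1 ∧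
    bT (b :: L') = bp b L' * b.mean + (1 - bp b L' + bp b L' * fQ L') * bT L' := by
  obtain ⟨hq0, hq1, _, _, _⟩ := hb
  obtain ⟨hQ0', hQ1', hmem⟩ := fQ_facts L' hL
  have hQpos : 0 < fQ L' := by
    obtain ⟨s, hs⟩ := List.exists_mem_of_ne_nil L' hne
    exact lt_of_lt_of_le (hL s hs).1 (hmem s hs)
  have hQc : fQ (b :: L') = fQ L' + b.q * (1 - fQ L') := rfl
  have hQc0 : 0 < fQ (b :: L') := by rw [hQc]; nlinarith
  have hqQ : b.q < fQ (b :: L') := by rw [hQc]; nlinarith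
  have hp0 : 0 < bp b L' := div_pos hq0 hQc0
  have hp1 : bp b L' < 1 := by unfold bp; rw [div_lt_one hQc0]; exact hqQ
  have hD0 : 0 < bD b L' := by
    unfold bD
    have : 0 < (1 - bp b L') * b.mean := mul_pos (by linarith) hR
    have : 0 ≤ bp b L' * (1 - fQ L') * bT L' := by positivity
    linarith
  -- closed forms of `1 − λ`, `1 − κ`
  have hlam1 : 1 - blam b L' = bD b L' / b.mean := by
    unfold blam bD; field_simp; ring
  have hkap1 : 1 - bkap b L' = bD b L' / bT L' := by
    unfold bkap bD; field_simp; ring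
  have hl0 : 0 < blam b L' := by
    unfold blam
    exact div_pos (mul_pos hp0 (by linarith)) hR
  have hl1 : blam b L' < 1 := by
    have : 0 < bD b L' / b.mean := div_pos hD0 hR
    linarith
  have hk0 : 0 < bkap b L' := by
    unfold bkap
    exact div_pos (by linarith) hT
  have hk1 : bkap b L' < 1 := by
    have : 0 < bD b L' / bT L' := div_pos hD0 hT
    linarith
  have hden : fQ L' + b.q * (1 - fQ L') ≠ 0 := by rw [← hQc]; exact hQc0.ne'
  have hTc : bT (b :: L') = bp b L' * b.mean + (1 - bp b L' + bp b L' * fQ L') * bT L' := by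
    unfold bT bp
    simp only [fmean]
    rw [hQc]
    field_simp
    ring
  exact ⟨hp0, hp1, hD0, hl0, hl1, hk0, hk1, hTc⟩

/-- the gated total mean of a non-empty tree-built compound is positive. [this work] -/
theorem fmean_pos_of_treeOK {x : ℝ} : ∀ (L : List Sib), (∀ s ∈ L, s.TreeOK x) → L ≠ [] → 0 < fmean L
  | [], _, hne => absurd rfl hne
  | [s], hL, _ => by
    simp only [fmean]
    have := Sib.qmean_pos s (hL s List.mem_cons_self)
    linarith
  | s :: t :: L, hL, _ => by
    have h1 := Sib.qmean_pos s (hL s List.mem_cons_self)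
    have h2 := fmean_pos_of_treeOK (t :: L) (fun r hr => hL r (List.mem_cons_of_mem s hr)) (by simp)
    show 0 < fmean (t :: L) + s.q * s.mean
    linarith

/-- the conditioned mean of a non-empty tree-built compound is positive. [this work] -/
theorem bT_pos {x : ℝ} (L : List Sib) (hL : ∀ s ∈ L, s.TreeOK x) (hne : L ≠ []) : 0 < bT L := by
  have hL' : ∀ s ∈ L, s.LawOK := fun s hs => (hL s hs).lawOK
  obtain ⟨_, _, hmem⟩ := fQ_facts L hL'
  obtain ⟨s, hs⟩ := List.exists_mem_of_ne_nil L hne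
  have hQ0 : 0 < fQ L := lt_of_lt_of_le (hL s hs).1 (hmem s hs)
  exact div_pos (fmean_pos_of_treeOK L hL hne) hQ0

/-- the bubble floor is positive on the region. [this work] -/
theorem bfl_pos {x : ℝ} : ∀ (L : List Sib), (∀ s ∈ L, s.TreeOK x) → BubbleOK L → 0 < bfl L
  | [], _, hB => absurd hB (by simp [BubbleOK])
  | [s], hL, _ => by
    simp only [bfl]
    exact ((hL s List.mem_cons_self).2.2.2.1.lawFacts).1
  | b :: s :: L'', hL, hB => by
    obtain ⟨hB', h1, h2⟩ := hB
    have hbT : b.TreeOK x := hL b List.mem_cons_self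
    have hLT : ∀ t ∈ s :: L'', t.TreeOK x := fun t ht => hL t (List.mem_cons_of_mem b ht)
    have hR : 0 < b.mean := (mul_pos_iff_of_pos_left hbT.1).1 (Sib.qmean_pos b hbT)
    obtain ⟨_, _, _, hl0, _, hk0, _, _⟩ := bubble_step_facts b (s :: L'') hbT.lawOK hR (fun t ht => (hLT t ht).lawOK) (by simp)
      (bT_pos (s :: L'') hLT (by simp)) h1 h2
    have hin := bfl_pos (s :: L'') hLT hB'
    have hx₁ := (hbT.2.2.2.1.lawFacts).1
    simp only [bfl]
    exact lt_min (lt_min hin (mul_pos hl0 hx₁)) (lt_min hx₁ (mul_pos hk0 hin))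

/-! ### The X-leaf as a family of versions -/

/-- the floor term of an X-leaf `b` hung at `λ = blam b L′`: `λ·R/M·y₀` when the split is legal (`λ·R < r`), else `λ·x₁(b)`. [this work] -/
def xfl (y0 : ℝ) (b : Sib) (L' : List Sib) : ℝ :=
  if blam b L' * b.mean < (b.r : ℝ) then blam b L' * b.mean / (b.M : ℝ) * y0 else blam b L' * b.x₁

/-- **the split-aware bubble floor**. [this work] -/
def bflS (y0 : ℝ) : List Sib → ℝ
  | [] => 1
  | [s] => s.x₁
  | b :: s :: L => min (min (bflS y0 (s :: L)) (xfl y0 b (s :: L))) (min b.x₁ (bkap b (s :: L) * bflS y0 (s :: L)))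

/-- **THE X-LEAF AS A FINITE FAMILY OF VERSIONS.**  For a tree-built sibling `b`, a gate `0 < λ < 1` and `0 < y₀ < 1`: `gate b.ρ λ` is a finite mixture
(weights `≥ 0`, sum `1`) of laws `gate ν_c g_c` with `0 < g_c < 1`, `ν_c` tree-built with at most `b.n` gates on `{0..t_c}`, `t_c ≤ b.M`, each of mean
`g_c·mean ν_c = λ·R` and floor `g_c·(floor ν_c) ≥` the X-floor term (`λR/M·y₀` if `λR < r`, blobs `δ_m`; else `λ·x₁`, the box itself). [this work] -/
theorem leaf_versions {x : ℝ} (b : Sib) (hb : b.TreeOK x) (lam : ℝ) (hl0 : 0 < lam) (hl1 : lam < 1) (y0 : ℝ) (hy0 : 0 < y0) (hy1 : y0 < 1) :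
    ∃ (C : Type) (_ : Fintype C) (θ g yv : C → ℝ) (t n : C → ℕ) (ν : C → ℕ → ℝ),
      (∀ c, 0 ≤ θ c) ∧ (∑ c, θ c = 1) ∧ (∀ h, gate b.ρ lam h = ∑ c, θ c * gate (ν c) (g c) h) ∧
      (∀ c, 0 < g c ∧ g c < 1 ∧ TreeBuiltN (yv c) (n c) (t c) (ν c) ∧ t c ≤ b.M ∧ n c ≤ b.n ∧
        g c * (∑ h ∈ Finset.range (t c + 1), (h : ℝ) * ν c h) = lam * b.mean ∧
        (if lam * b.mean < (b.r : ℝ) then lam * b.mean / (b.M : ℝ) * y0 else lam * b.x₁) ≤ g c * yv c) := by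
  obtain ⟨hq0, hq1, hxq, hT, hnp⟩ := hb
  obtain ⟨hx₁0, hx₁1, ρ0, ρM, ρ1, ρta⟩ := hT.lawFacts
  have hbL : b.LawOK := ⟨hq0, hq1, ρ0, ρM, ρ1⟩
  have hR : 0 < b.mean := (mul_pos_iff_of_pos_left hq0).1 (Sib.qmean_pos b ⟨hq0, hq1, hxq, hT, hnp⟩)
  by_cases hs : lam * b.mean < (b.r : ℝ)
  · -- SPLIT: versions indexed by `Fin b.M` (atom `m = c+1`, replaced by `max m r` when uncharged — weight 0 there)
    have hρ00 : b.ρ 0 = 0 := by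
      by_contra h0
      have : b.r ≤ 0 := b.r_le h0
      have : (b.r : ℝ) ≤ 0 := by exact_mod_cast this
      nlinarith [mul_pos hl0 hR]
    obtain ⟨hr1, hrM⟩ := b.one_le_r hbL hρ00
    have hrpos : (0 : ℝ) < b.r := by exact_mod_cast hr1
    -- the atom used for index `c`
    let mm : Fin b.M → ℕ := fun c => max (c.val + 1) b.r
    have hmm_pos : ∀ c, 0 < (mm c : ℝ) := fun c => by
      have : 1 ≤ mm c := le_trans (Nat.succ_le_succ (Nat.zero_le _)) (le_max_left _ _)
      exact_mod_cast this
    have hmm_r : ∀ c, b.r ≤ mm c := fun c => le_max_right _ _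
    have hmm_M : ∀ c, mm c ≤ b.M := fun c => max_le c.isLt hrM
    refine ⟨Fin b.M, inferInstance, fun c => b.ρ (c.val + 1) * ((c.val + 1 : ℕ) : ℝ) / b.mean, fun c => lam * b.mean / (mm c : ℝ),
      fun _ => y0, fun c => mm c, fun _ => 0, fun c => fun k => if k = mm c then (1 : ℝ) else 0, fun c => ?_, ?_, fun h => ?_, fun c => ?_⟩
    · exact div_nonneg (mul_nonneg (ρ0 _) (Nat.cast_nonneg _)) hR.le
    · -- Σ θ = 1
      have e := Fin.sum_univ_eq_sum_range (fun i => b.ρ (i + 1) * ((i + 1 : ℕ) : ℝ) / b.mean) b.M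
      rw [e]
      have e2 : ∑ i ∈ Finset.range (b.M + 1), b.ρ i * ((i : ℕ) : ℝ) / b.mean = 1 := by
        rw [← Finset.sum_div, div_eq_one_iff_eq hR.ne']
        unfold Sib.mean
        exact Finset.sum_congr rfl fun i _ => by ring
      rw [Finset.sum_range_succ'] at e2
      simpa using e2
    · -- the identity
      have hmeanE : (∑ k ∈ Finset.range (b.M + 1), (k : ℝ) * b.ρ k) = b.mean := rfl
      have e0 := gate_eq_sum_regated_atoms b.M b.ρ lam ρM ρ1 hρ00 (by rw [hmeanE]; exact hR.ne') h
      rw [hmeanE] at e0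
      rw [e0, Finset.sum_range_succ']
      have hz : b.ρ 0 * ((0 : ℕ) : ℝ) / b.mean * gate (fun k => if k = 0 then (1 : ℝ) else 0) (lam * b.mean / ((0 : ℕ) : ℝ)) h = 0 := by simp
      rw [hz, add_zero, ← Fin.sum_univ_eq_sum_range (fun i => b.ρ (i + 1) * ((i + 1 : ℕ) : ℝ) / b.mean *
        gate (fun k => if k = i + 1 then (1 : ℝ) else 0) (lam * b.mean / ((i + 1 : ℕ) : ℝ)) h) b.M]
      refine Finset.sum_congr rfl fun c _ => ?_
      by_cases hc : b.r ≤ c.val + 1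
      · have : mm c = c.val + 1 := max_eq_left hc
        simp only [this]
      · have hunch : b.ρ (c.val + 1) = 0 := by
          by_contra hne; exact hc (b.r_le hne)
        simp only [hunch, zero_mul, zero_div]
    · -- per version
      have hg0 : 0 < lam * b.mean / (mm c : ℝ) := div_pos (mul_pos hl0 hR) (hmm_pos c)
      have hg1 : lam * b.mean / (mm c : ℝ) < 1 := by
        rw [div_lt_one (hmm_pos c)]
        exact lt_of_lt_of_le hs (by exact_mod_cast hmm_r c)
      refine ⟨hg0, hg1, treeBuiltN_point (mm c) hy0 hy1, hmm_M c, Nat.zero_le _, ?_, ?_⟩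
      · -- mean of the blob
        have : ∑ h ∈ Finset.range (mm c + 1), (h : ℝ) * (if h = mm c then (1 : ℝ) else 0) = (mm c : ℝ) := by
          have e : ∀ h ∈ Finset.range (mm c + 1), (h : ℝ) * (if h = mm c then (1 : ℝ) else 0) = if h = mm c then (mm c : ℝ) else 0 := by
            intro h _; split_ifs with hh
            · rw [hh, mul_one]
            · rw [mul_zero]
          rw [Finset.sum_congr rfl e, Finset.sum_ite_eq' (Finset.range (mm c + 1)) (mm c), if_pos (Finset.mem_range.2 (Nat.lt_succ_self _))]
        rw [this, div_mul_cancel₀ _ (hmm_pos c).ne']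
      · -- floor
        rw [if_pos hs]
        have hM0 : (0 : ℝ) < b.M := by exact_mod_cast (lt_of_lt_of_le hr1 hrM)
        have h1 : lam * b.mean / (b.M : ℝ) ≤ lam * b.mean / (mm c : ℝ) :=
          div_le_div_of_nonneg_left (mul_pos hl0 hR).le (hmm_pos c) (by exact_mod_cast hmm_M c)
        exact mul_le_mul_of_nonneg_right h1 hy0.le
  · -- NO SPLIT: the box itself
    refine ⟨Unit, inferInstance, fun _ => 1, fun _ => lam, fun _ => b.x₁, fun _ => b.M, fun _ => b.n, fun _ => b.ρ, fun _ => zero_le_one,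
      by simp, fun h => by simp, fun _ => ⟨hl0, hl1, hT, le_rfl, le_rfl, rfl, ?_⟩⟩
    rw [if_neg hs]

/-- the split-aware bubble floor is positive on the region (`0 < y₀`). [this work] -/
theorem bflS_pos {x : ℝ} (y0 : ℝ) (hy0 : 0 < y0) : ∀ (L : List Sib), (∀ s ∈ L, s.TreeOK x) → BubbleOK L → 0 < bflS y0 L
  | [], _, hB => absurd hB (by simp [BubbleOK])
  | [s], hL, _ => by
    simp only [bflS]
    exact ((hL s List.mem_cons_self).2.2.2.1.lawFacts).1
  | b :: s :: L'', hL, hB => by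
    obtain ⟨hB', h1, h2⟩ := hB
    have hbT : b.TreeOK x := hL b List.mem_cons_self
    have hLT : ∀ t ∈ s :: L'', t.TreeOK x := fun t ht => hL t (List.mem_cons_of_mem b ht)
    have hR : 0 < b.mean := (mul_pos_iff_of_pos_left hbT.1).1 (Sib.qmean_pos b hbT)
    obtain ⟨_, _, _, hl0, _, hk0, _, _⟩ := bubble_step_facts b (s :: L'') hbT.lawOK hR (fun t ht => (hLT t ht).lawOK) (by simp)
      (bT_pos (s :: L'') hLT (by simp)) h1 h2
    have hin := bflS_pos y0 hy0 (s :: L'') hLT hB'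
    have hx₁ := (hbT.2.2.2.1.lawFacts).1
    have hxfl : 0 < xfl y0 b (s :: L'') := by
      unfold xfl
      split_ifs with hs
      · have hM : (0 : ℝ) < b.M := by
          have hρ00 : b.ρ 0 = 0 := by
            by_contra h0
            have : b.r ≤ 0 := b.r_le h0
            have : (b.r : ℝ) ≤ 0 := by exact_mod_cast this
            nlinarith [mul_pos hl0 hR]
          obtain ⟨hr1, hrM⟩ := b.one_le_r hbT.lawOK hρ00
          exact_mod_cast (lt_of_lt_of_le hr1 hrM)
        exact mul_pos (div_pos (mul_pos hl0 hR) hM) hy0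
      · exact mul_pos hl0 hx₁
    simp only [bflS]
    exact lt_min (lt_min hin hxfl) (lt_min hx₁ (mul_pos hk0 hin))

end LawDec
end Quant
end Summit.CriticalPhenomena.PercolationContinuityZ3.Theorems
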